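import Mathlib
import HarnessLib
import Summits.NavierStokesRegularity.NavierStokesRegularity.Theorems.UnthreadedDoorNetFluxStratumOneSidedLaw
import Summits.NavierStokesRegularity.NavierStokesRegularity.Theorems.UnthreadedDoorNetFluxDenseFiniteZeroScalarLiouville
import Summits.NavierStokesRegularity.NavierStokesRegularity.Theorems.UnthreadedDoorNetFluxNF1aExtremalHeadEMFIoo

/-!
# Route `UnthreadedDoor`, crux `PoloidalLiouville` (stmt-NavierStokesRegularity-1222), WALL W1 — crux idea «null-time» (ns-idea-14 g5,
# `Cruxes/PoloidalLiouville/NullTimeSketch.lean`): stub AE-1 `OneSidedLawOffNull`, PROVED (by name)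

`NetFlux.oneSidedLawOffNull : <body of NullTime.OneSidedLawOffNull VERBATIM, analyticFinitePred / sphCrit unfolded as in p684266>`: the one-sided
netflux law with conjuncts 1–3 (continuity of `(t,r) ↦ netFlux(T t, r)`, one-sided `r`-derivatives `ℓp`, `ℓm`) on the whole window `]t₀,0[` and
conjunct 4 (the backward-difference inequality) at every window time OUTSIDE a closed exceptional set `D`, given the height-head stratum
property («`v t` analytic, `T t` analytic off `x₀`, finite-vorticity-zero radii dense») at the times `t ∉ D` only.

PROOF (no new analysis).  Conjuncts 1–3 are stratum-free envelope facts (`continuousOn_netFlux_family`, `exists_oneSided_deriv_netFlux`,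
p672773).  Conjunct 4 at `t ∉ D`: `D` is closed, so a whole sub-window `]α,β[ ∋ t` of `]t₀,0[` misses `D`; TRANSLATE it in time to
`]α−β,0[` (`NF1a.contDiffOn_uncurry_timeShift`, p685855; the curled law (E1) transports by `deriv_comp_add_const`), where EVERY time is on the
stratum, apply the landed stratum law `oneSidedNetFluxLawOn_of_extremalHeadEMFOn` (p678532) fed with the landed hinge (a) on the analytic
dense-finite-zero stratum `extremalHeadEMF_analyticFinite` (p684266), and carry conjunct 4 back to time `t`; the one-sided derivatives it
produces agree with `ℓp t R`, `ℓm t a` by uniqueness of one-sided derivatives (`UniqueDiffWithinAt.eq_deriv` on `Ioi R` / `Iio a`).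
In the sketch: `theorem stub_oneSidedLawOffNull : OneSidedLawOffNull := Theorems.PoloidalLiouville.NetFlux.oneSidedLawOffNull`.

HONEST LABEL: one S stub of the a.e.-time chain (crux idea «null-time», critic V19 PASS-WITH-PRICE; its lever AE-2 is being re-typed);
`PoloidalLiouville` (1222), C⁻, W1 and the summit stay OPEN; NO Navier–Stokes regularity statement is proved.
`--supports stmt-NavierStokesRegularity-1222 --as helper`.  [folklore]
-/

noncomputable section

-- the summit and its single sub-problem share the name (CONVENTIONS §1)
set_option linter.dupNamespace false

open Set Function Filter Topology InnerProductSpace MeasureTheory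
open scoped RealInnerProductSpace NNReal

namespace Summit.NavierStokesRegularity.NavierStokesRegularity.Theorems.PoloidalLiouville.NetFlux

open Literature.Analysis Literature.Analysis.FluidPDE

/-- Time translation of the curled potential law (E1): `CurledLaw v x₀ T 𝒯` at the times `s + β ∈ 𝒯` gives `CurledLaw` for the translated
data `s ↦ v (s + β)`, `s ↦ T (s + β)` on `{s | s + β ∈ 𝒯}`. [folklore] -/
theorem curledLaw_timeShift {v : ℝ → E3 → E3} {x₀ : E3} {T : ℝ → E3 → ℝ} {𝒯 𝒯' : Set ℝ} (β : ℝ)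
    (h𝒯 : ∀ s ∈ 𝒯', s + β ∈ 𝒯) (hE : CurledLaw v x₀ T 𝒯) :
    CurledLaw (fun s => v (s + β)) x₀ (fun s => T (s + β)) 𝒯' := by
  intro s hs x hx
  have h := hE (s + β) (h𝒯 s hs) x hx
  have e : (fun z : E3 => deriv (fun σ => T (σ + β) z) s + ⟪v (s + β) z, gradient (T (s + β)) z⟫
        - Laplacian.laplacian (T (s + β)) z)
      = fun z => deriv (fun σ => T σ z) (s + β) + ⟪v (s + β) z, gradient (T (s + β)) z⟫
        - Laplacian.laplacian (T (s + β)) z := by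
    funext z
    rw [show deriv (fun σ => T (σ + β) z) s = deriv (fun σ => T σ z) (s + β) from
      deriv_comp_add_const (fun σ => T σ z) β s]
  show cross (gradient (fun z : E3 => deriv (fun σ => T (σ + β) z) s + ⟪v (s + β) z, gradient (T (s + β)) z⟫
      - Laplacian.laplacian (T (s + β)) z) x) (x - x₀) =
    cross (gradient (fun z => ⟪v (s + β) z, z - x₀⟫) x) (gradient (T (s + β)) x)
  rw [e]
  exact h

/-- **AE-1 `OneSidedLawOffNull`, proved**: the one-sided netflux law off a closed exceptional time set — conjuncts 1–3 on the whole window,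
conjunct 4 at every `t ∉ D` — from the height-head stratum property at the times `t ∉ D`.  Statement = the sketch's `NullTime.OneSidedLawOffNull`
verbatim (`analyticFinitePred`, `sphCrit` unfolded).  No NS statement is involved. [folklore] -/
theorem oneSidedLawOffNull :
    ∀ (D : Set ℝ), IsClosed D → ∀ (v : ℝ → E3 → E3) (x₀ : E3) (T : ℝ → E3 → ℝ) (V : ℝ → ℝ) (t₀ : ℝ),
    ContDiffOn ℝ (⊤ : ℕ∞) (uncurry v) (Ioo t₀ 0 ×ˢ univ) →
    ContDiffOn ℝ (⊤ : ℕ∞) (uncurry T) (Ioo t₀ 0 ×ˢ ({x₀}ᶜ : Set E3)) →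
    (∀ t ∈ Ioo t₀ 0, ∀ x, ‖v t x‖ ≤ V t) →
    CurledLaw v x₀ T (Ioo t₀ 0) →
    (∀ t ∈ Ioo t₀ 0, t ∉ D →
        AnalyticOnNhd ℝ (v t) (univ : Set E3) ∧ AnalyticOnNhd ℝ (T t) ({x₀}ᶜ : Set E3) ∧
          Ioi (0 : ℝ) ⊆ closure {r : ℝ | 0 < r ∧
            {x : E3 | x ∈ Metric.sphere x₀ r ∧ cross (gradient (T t) x) (x - x₀) = 0}.Finite}) →
    ∃ ℓp ℓm : ℝ → ℝ → ℝ,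
      ContinuousOn (fun p : ℝ × ℝ => netFlux (T p.1) x₀ p.2) (Ioo t₀ 0 ×ˢ Ioi 0) ∧
      (∀ t ∈ Ioo t₀ 0, ∀ r > 0, HasDerivWithinAt (fun ρ => netFlux (T t) x₀ ρ) (ℓp t r) (Ioi r) r) ∧
      (∀ t ∈ Ioo t₀ 0, ∀ r > 0, HasDerivWithinAt (fun ρ => netFlux (T t) x₀ ρ) (ℓm t r) (Iio r) r) ∧
      (∀ t ∈ Ioo t₀ 0, t ∉ D → ∀ a R : ℝ, 0 < a → a < R → ∀ ε > 0, ∃ δ > 0, ∀ h ∈ Ioo 0 δ,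
          (∫ r in Ioo a R, netFlux (T t) x₀ r) - (∫ r in Ioo a R, netFlux (T (t - h)) x₀ r)
            ≤ h * (ℓp t R - ℓm t a + V t * (netFlux (T t) x₀ R + netFlux (T t) x₀ a) + ε)) := by
  intro D hD v x₀ T V t₀ hv hT hV hE1 hS
  -- conjuncts 1–3: stratum-free envelope facts
  have hex : ∀ t r : ℝ, ∃ lp lm : ℝ, t ∈ Ioo t₀ 0 → 0 < r →
      HasDerivWithinAt (fun ρ => netFlux (T t) x₀ ρ) lp (Ioi r) r ∧
        HasDerivWithinAt (fun ρ => netFlux (T t) x₀ ρ) lm (Iio r) r := by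
    intro t r
    by_cases ht : t ∈ Ioo t₀ 0
    · by_cases hr : 0 < r
      · obtain ⟨lp, lm, hp, hm, -⟩ := exists_oneSided_deriv_netFlux hT ht hr
        exact ⟨lp, lm, fun _ _ => ⟨hp, hm⟩⟩
      · exact ⟨0, 0, fun _ h => absurd h hr⟩
    · exact ⟨0, 0, fun h _ => absurd h ht⟩
  choose ℓp ℓm hℓ using hex
  refine ⟨ℓp, ℓm, continuousOn_netFlux_family hT.continuousOn, fun t ht r hr => (hℓ t r ht hr).1,
    fun t ht r hr => (hℓ t r ht hr).2, ?_⟩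
  intro t ht htD a R ha haR ε hε
  -- a sub-window `]α, β[ ∋ t` of `]t₀, 0[` missing the closed set `D`
  obtain ⟨η, hη, hηD⟩ : ∃ η > 0, ∀ s : ℝ, |s - t| < η → s ∉ D := by
    obtain ⟨η, hη, hball⟩ := Metric.isOpen_iff.1 hD.isOpen_compl t htD
    exact ⟨η, hη, fun s hs => hball (by rw [Metric.mem_ball, Real.dist_eq]; exact hs)⟩
  set α : ℝ := max t₀ (t - η) with hα
  set β : ℝ := min 0 (t + η / 2) with hβ
  have htβ : t < β := lt_min ht.2 (by linarith)
  have hαt : α < t := max_lt ht.1 (by linarith)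
  have hsub : ∀ s ∈ Ioo α β, s ∈ Ioo t₀ 0 ∧ s ∉ D := by
    intro s hs
    have h1 : t₀ < s := lt_of_le_of_lt (le_max_left _ _) hs.1
    have h2 : s < 0 := lt_of_lt_of_le hs.2 (min_le_left _ _)
    have h3 : t - η < s := lt_of_le_of_lt (le_max_right _ _) hs.1
    have h4 : s < t + η / 2 := lt_of_lt_of_le hs.2 (min_le_right _ _)
    exact ⟨⟨h1, h2⟩, hηD s (by rw [abs_lt]; constructor <;> linarith)⟩
  have hmem' : ∀ {s : ℝ}, s ∈ Ioo (α - β) 0 → s + β ∈ Ioo α β := fun hs =>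
    ⟨by linarith [hs.1], by linarith [hs.2]⟩
  have hwin : Ioo α β ⊆ Ioo t₀ 0 := fun s hs => (hsub s hs).1
  -- the translated data on `]α − β, 0[`
  have hv' : ContDiffOn ℝ (⊤ : ℕ∞) (uncurry fun s => v (s + β)) (Ioo (α - β) 0 ×ˢ (univ : Set E3)) :=
    NF1a.contDiffOn_uncurry_timeShift (hv.mono (prod_mono hwin subset_rfl))
  have hT' : ContDiffOn ℝ (⊤ : ℕ∞) (uncurry fun s => T (s + β)) (Ioo (α - β) 0 ×ˢ ({x₀}ᶜ : Set E3)) :=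
    NF1a.contDiffOn_uncurry_timeShift (hT.mono (prod_mono hwin subset_rfl))
  have hV' : ∀ s ∈ Ioo (α - β) 0, ∀ x, ‖(fun s => v (s + β)) s x‖ ≤ (fun s => V (s + β)) s :=
    fun s hs x => hV _ (hwin (hmem' hs)) x
  have hE1' : CurledLaw (fun s => v (s + β)) x₀ (fun s => T (s + β)) (Ioo (α - β) 0) :=
    curledLaw_timeShift β (fun s hs => hwin (hmem' hs)) hE1
  -- the stratum predicate (analytic dense-finite-zero), Theorems-side
  set Sa : (ℝ → E3 → E3) → E3 → (ℝ → E3 → ℝ) → ℝ → Prop := fun v x₀ T t =>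
    AnalyticOnNhd ℝ (v t) (univ : Set E3) ∧ AnalyticOnNhd ℝ (T t) ({x₀}ᶜ : Set E3) ∧
      Ioi (0 : ℝ) ⊆ closure {r : ℝ | 0 < r ∧
        {x : E3 | x ∈ Metric.sphere x₀ r ∧ cross (gradient (T t) x) (x - x₀) = 0}.Finite} with hSa
  have hS' : ∀ s ∈ Ioo (α - β) 0, Sa (fun s => v (s + β)) x₀ (fun s => T (s + β)) s :=
    fun s hs => hS _ (hwin (hmem' hs)) (hsub _ (hmem' hs)).2
  obtain ⟨ℓp', ℓm', -, hp', hm', h4'⟩ :=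
    oneSidedNetFluxLawOn_of_extremalHeadEMFOn Sa extremalHeadEMF_analyticFinite (fun s => v (s + β)) x₀ (fun s => T (s + β))
      (fun s => V (s + β)) (α - β) hv' hT' hV' hE1' hS'
  -- conjunct 4 at the translated time `t − β`, carried back
  have hs0 : t - β ∈ Ioo (α - β) 0 := ⟨by linarith, by linarith⟩
  obtain ⟨δ, hδ, hδh⟩ := h4' (t - β) hs0 a R ha haR ε hε
  refine ⟨δ, hδ, fun h hh => ?_⟩
  have key := hδh h hh
  have hp1 := hp' (t - β) hs0 R (ha.trans haR)
  have hm1 := hm' (t - β) hs0 a ha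
  simp only [sub_add_cancel] at key hp1 hm1
  have e4 : ℓp' (t - β) R = ℓp t R := (uniqueDiffWithinAt_Ioi R).eq_deriv _ hp1 (hℓ t R ht (ha.trans haR)).1
  have e5 : ℓm' (t - β) a = ℓm t a := (uniqueDiffWithinAt_Iio a).eq_deriv _ hm1 (hℓ t a ht ha).2
  have e2 : t - β - h + β = t - h := by ring
  rw [e4, e5, e2] at key
  exact key

end Summit.NavierStokesRegularity.NavierStokesRegularity.Theorems.PoloidalLiouville.NetFlux

end
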